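import Literature.MathematicalPhysics.QuantumLattice.LiebRobinsonFnwUniqueProofs
import Literature.MathematicalPhysics.QuantumLattice.SpinChainsAkltOpenDegeneracyProofs
import Literature.MathematicalPhysics.QuantumLattice.TransferOperatorPerron
import HarnessLib

/-!
# The open chain of a normal MPS: kernel of the parent Hamiltonian and the local gap

Sibling proof file of `Literature/MathematicalPhysics/QuantumLattice/LiebRobinson.lean`
(theorem-only: no definition, no named fact), a step towards the discharge of
`fannes_nachtergaele_werner_gap` (**hubbard.S16**; Fannes–Nachtergaele–Werner 1992, Thm. 6.4),
building on `LiebRobinsonFnwUniqueProofs.lean` (the intersection property for a general block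
length, `exists_boundary_of_blockSlices`).

* `parentHamiltonianOpen_mulVec_eq_zero_iff` — for a tensor injective at a positive length `m`
  and `n ≥ ℓ = m + 1`: `H_{[1,n]} ψ = 0 ↔ ψ = ψ_X` for some boundary matrix `X`
  (`ker H_{[1,n]} = 𝒢_n`; FNW Lemma 5.5 iterated, PVWC Thm. 9);
* `exists_pos_smul_parentHamiltonianOpen_sub_parentLocalTerm` — **the local gap** (FNW (6.7)):
  `h_n ≤ c H_{[1,n]}` for some `c > 0`, where `h_n = 1 - P_{𝒢_n}` is the `n`-site projection with
  the same kernel (`c⁻¹` = smallest positive eigenvalue of `H_{[1,n]}`, produced as a lower bound of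
  the positive definite `H_{[1,n]} + (1 - h_n)`);
* helpers `not_mem_chainBlock_iff`, `slice_localOp_chainBlock_submatrix_mulVec` (block slices of
  `(N ⊗ 𝟙) ψ` are `N` applied to the block slices of `ψ`),
  `localOp_chainBlock_parentLocalTerm_mulVec_mpsWithBoundary` (each block term kills every `ψ_B`).

## Sources

* M. Fannes, B. Nachtergaele, R. F. Werner, *Finitely correlated states on quantum spin chains*,
  Comm. Math. Phys. **144** (1992) 443–490 (held: `paper:doi-10-1007-bf02099178`), §5 p. 468
  (kernel of `H_{{1,…,m}}` = intersection of the kernels of the `h_k`), Lemma 5.5, and §6, proof of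
  Theorem 6.4, p. 478: "the positive operator `h` can be bounded from below by a multiple of the
  projection `𝟙 - G_{2p}` with the same kernel, i.e. `h ≥ γ_{2p} (𝟙 - G_{2p})` (6.7)".
  [FannesNachtergaeleWernerCMP1992]
* D. Perez-Garcia, F. Verstraete, M. M. Wolf, J. I. Cirac, Quantum Inf. Comput. **7** (2007) 401,
  §4.1.1 Theorem 9 (uniqueness with open boundary conditions). [PerezGarciaVerstraeteWolfCiracQIC2007]
-/

noncomputable section

open Matrix
open scoped ComplexOrder MatrixOrder

namespace Literature.MathematicalPhysics.QuantumLattice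

section QLattice

variable {q D : ℕ}

/-! ### Block slices of local operators on the open chain -/

/-- A site of the open chain lies off the block `{x, …, x+ℓ-1}` iff it is `< x` or `≥ x + ℓ`.
[folklore] -/
theorem not_mem_chainBlock_iff {L ℓ : ℕ} {x : Fin L} (h : (x : ℕ) + ℓ ≤ L) (y : Fin L) :
    y ∉ chainBlock L ℓ x h ↔ (y : ℕ) < x ∨ (x : ℕ) + ℓ ≤ y := by
  constructor
  · intro hy
    by_contra hc
    push Not at hc
    apply hy
    simp only [chainBlock, Finset.mem_image, Finset.mem_univ, true_and]
    exact ⟨⟨y - x, by omega⟩, Fin.ext (by simp; omega)⟩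
  · intro hy hmem
    simp only [chainBlock, Finset.mem_image, Finset.mem_univ, true_and] at hmem
    obtain ⟨i, hi⟩ := hmem
    have := congrArg Fin.val hi
    simp at this
    omega

/-- **Block slices of a block operator.** The block slices of `(N ⊗ 𝟙) ψ` along the block carrying
`N` are `N` applied to the block slices of `ψ`:
`(w ↦ ((N ⊗ 𝟙) ψ)(σ[x,… := w])) = N · (w ↦ ψ(σ[x,… := w]))`. Bratteli–Robinson II §6.2.1
(`A ⊗ 𝟙` acts on the factor `𝓗_X`). [folklore] -/
theorem slice_localOp_chainBlock_submatrix_mulVec {L ℓ : ℕ} (x : Fin L) (h : (x : ℕ) + ℓ ≤ L)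
    (N : Op (Fin ℓ) q) (ψ : TensorIndex (Fin L) q → ℂ) (σ : TensorIndex (Fin L) q) :
    (fun w : Fin ℓ → Fin q =>
      (localOp (chainBlock L ℓ x h) (N.submatrix (fun σ i => σ (chainBlockSite L ℓ x h i))
        (fun σ i => σ (chainBlockSite L ℓ x h i))) *ᵥ ψ)
        (Function.extend (fun i : Fin ℓ => (⟨x + i, by omega⟩ : Fin L)) w σ)) =
      N *ᵥ fun w => ψ (Function.extend (fun i : Fin ℓ => (⟨x + i, by omega⟩ : Fin L)) w σ) := by
  funext w
  rw [localOp_chainBlock_submatrix_mulVec_apply]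
  simp only [extend_extend_of_injective (blockSite_injective x h),
    (blockSite_injective x h).extend_apply]

/-- **A block term of the parent Hamiltonian kills every boundary MPS on the chain**: the block
slices of `ψ_B` are boundary MPS on `ℓ` sites (`mpsWithBoundary_extend_blockSite`), which are
annihilated by `h = 1 - P_{𝒢_ℓ}`. Fannes–Nachtergaele–Werner (1992) §5, Lemma 5.5 (the trivial
inclusion) and Def. 5.4. [cite: FannesNachtergaeleWernerCMP1992, §5 Def. 5.4 and Lemma 5.5] -/
theorem localOp_chainBlock_parentLocalTerm_mulVec_mpsWithBoundary {L ℓ : ℕ} (x : Fin L)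
    (h : (x : ℕ) + ℓ ≤ L) (A : MPSTensor q D) (B : Matrix (Fin D) (Fin D) ℂ) :
    localOp (chainBlock L ℓ x h) ((parentLocalTerm ℓ A).submatrix
        (fun σ i => σ (chainBlockSite L ℓ x h i)) (fun σ i => σ (chainBlockSite L ℓ x h i))) *ᵥ
      mpsWithBoundary L A B = 0 := by
  funext σ
  rw [localOp_chainBlock_submatrix_mulVec_apply, mpsWithBoundary_extend_blockSite h A B σ,
    parentLocalTerm_mulVec_mpsWithBoundary]
  rfl

/-! ### Kernel of the open-chain parent Hamiltonian -/

/-- **Kernel of the open-chain parent Hamiltonian of a normal tensor** (`n ≥ ℓ = m + 1`, words of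
the positive length `m` spanning `M_D(ℂ)`): `H_{[1,n]} ψ = 0` iff `ψ = ψ_X` is a boundary MPS on
`n` sites. `⇐` is frustration-freeness (`parentHamiltonianOpen_mulVec_mpsWithBoundary_eq_zero_holds`);
`⇒`: the positive block terms vanish separately (`mulVec_eq_zero_of_sum_posSemidef`), so every
`ℓ`-block slice of `ψ` lies in `ker h = 𝒢_ℓ` (`localOp_chainBlock_submatrix_mulVec_eq_zero_iff`,
`exists_mpsWithBoundary_of_parentLocalTerm_mulVec_eq_zero'`), and the iterated intersection
property (`exists_boundary_of_blockSlices`, FNW Lemma 5.5) gives `ψ ∈ 𝒢_n`.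
Fannes–Nachtergaele–Werner (1992) §5, p. 468 and Lemma 5.5; Perez-Garcia–Verstraete–Wolf–Cirac
(2007) §4.1.1 Theorem 9. [cite: FannesNachtergaeleWernerCMP1992, §5 Lemma 5.5] -/
theorem parentHamiltonianOpen_mulVec_eq_zero_iff {A : MPSTensor q D} {m : ℕ}
    (hinj : IsInjectiveMPS A m) (hm : 0 < m) {n : ℕ} (hn : m + 1 ≤ n)
    (ψ : TensorIndex (Fin n) q → ℂ) :
    parentHamiltonianOpen n (m + 1) A *ᵥ ψ = 0 ↔
      ∃ X : Matrix (Fin D) (Fin D) ℂ, ψ = mpsWithBoundary n A X := by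
  constructor
  · intro hz
    obtain ⟨X, hX⟩ := exists_boundary_of_blockSlices hinj hm n hn ψ fun j hj σ => by
      have hj' : ((⟨j, by omega⟩ : Fin n) : ℕ) + (m + 1) ≤ n := hj
      -- the block term at `j` kills `ψ`
      have hterm := mulVec_eq_zero_of_sum_posSemidef (s := Finset.univ)
        (fun (y : Fin n) _ => show Matrix.PosSemidef
          (if h : (y : ℕ) + (m + 1) ≤ n then localOp (chainBlock n (m + 1) y h)
            ((parentLocalTerm (m + 1) A).submatrix
              (fun σ i => σ (chainBlockSite n (m + 1) y h i))
              (fun σ i => σ (chainBlockSite n (m + 1) y h i))) else 0) from by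
          split_ifs with h
          · exact posSemidef_localOp _ ((parentLocalTerm_posSemidef (m + 1) A).submatrix _)
          · exact PosSemidef.zero) hz ⟨j, by omega⟩ (Finset.mem_univ _)
      rw [dif_pos hj'] at hterm
      -- so the block slice at `σ` is a boundary MPS
      have hslice := (localOp_chainBlock_submatrix_mulVec_eq_zero_iff _ hj' _ ψ).1 hterm σ
      obtain ⟨B, hB⟩ := exists_mpsWithBoundary_of_parentLocalTerm_mulVec_eq_zero' _ _ _ hslice
      refine ⟨B, fun τ hτ => ?_⟩
      have hτ' : ∀ y, y ∉ chainBlock n (m + 1) ⟨j, by omega⟩ hj' → σ y = τ y := fun y hy =>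
        hτ y ((not_mem_chainBlock_iff hj' y).1 hy)
      have h1 := congrFun hB (fun i : Fin (m + 1) => τ ⟨j + i, by omega⟩)
      simp only at h1
      rw [h1]
      congr 1
      exact (extend_blockSite_eq_of_forall hj' hτ').symm
    exact ⟨X, funext hX⟩
  · rintro ⟨X, rfl⟩
    exact parentHamiltonianOpen_mulVec_mpsWithBoundary_eq_zero_holds n (m + 1) A X

/-! ### The local gap: `h_{[1,n]} ≤ c H_{[1,n]}` -/

/-- **The local gap of the open chain (`h ≥ γ_{2p} (𝟙 - G_{2p})`, FNW (6.7)).** For a tensor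
injective at the positive length `m` and `n ≥ m + 1`, the `n`-site projection
`h_n = 1 - P_{𝒢_n}` (`parentLocalTerm n A`) and the open-chain Hamiltonian
`H = Σ_{x+ℓ ≤ n} h_{x,…,x+ℓ-1}` with `ℓ = m + 1` have the same kernel `𝒢_n`
(`parentHamiltonianOpen_mulVec_eq_zero_iff`), so `h_n ≤ c H` for some `c > 0` (`c⁻¹` is the
smallest positive eigenvalue of `H`, obtained here as a lower bound of the positive definite
`H + (1 - h_n)`). Fannes–Nachtergaele–Werner (1992), proof of Thm. 6.4, p. 478: "the positive
operator `h` can be bounded from below by a multiple of the projection `𝟙 - G_{2p}` with the same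
kernel, i.e. `h ≥ γ_{2p} (𝟙 - G_{2p})`". [cite: FannesNachtergaeleWernerCMP1992, Thm. 6.4] -/
theorem exists_pos_smul_parentHamiltonianOpen_sub_parentLocalTerm {A : MPSTensor q D} {m : ℕ}
    (hinj : IsInjectiveMPS A m) (hm : 0 < m) {n : ℕ} (hn : m + 1 ≤ n) :
    ∃ c : ℝ, 0 < c ∧
      ((c : ℂ) • parentHamiltonianOpen n (m + 1) A - parentLocalTerm n A).PosSemidef := by
  set H := parentHamiltonianOpen n (m + 1) A with hHdef
  set P := parentLocalTerm n A with hPdef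
  have hH : H.PosSemidef := parentHamiltonianOpen_posSemidef n (m + 1) A
  have hPh : P.IsHermitian := projMatrix_isHermitian _
  have hPP : P * P = P := projMatrix_mul_self _
  have hPpsd : P.PosSemidef := parentLocalTerm_posSemidef n A
  -- common kernel
  have hker₁ : ∀ v, P *ᵥ v = 0 → H *ᵥ v = 0 := by
    intro v hv
    obtain ⟨B, rfl⟩ := exists_mpsWithBoundary_of_parentLocalTerm_mulVec_eq_zero' n A v hv
    exact parentHamiltonianOpen_mulVec_mpsWithBoundary_eq_zero_holds n (m + 1) A B
  have hker₂ : ∀ v, H *ᵥ v = 0 → P *ᵥ v = 0 := by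
    intro v hv
    obtain ⟨X, rfl⟩ := (parentHamiltonianOpen_mulVec_eq_zero_iff hinj hm hn v).1 hv
    exact parentLocalTerm_mulVec_mpsWithBoundary n A X
  -- `H' = H + (1 - P)` is positive definite
  have h1P : (1 - P).IsHermitian := isHermitian_one.sub hPh
  have h1Psq : (1 - P) * (1 - P) = 1 - P := by
    simp [Matrix.sub_mul, Matrix.mul_sub, hPP]
  have hquad1P : ∀ v : TensorIndex (Fin n) q → ℂ,
      star v ⬝ᵥ (1 - P) *ᵥ v = star ((1 - P) *ᵥ v) ⬝ᵥ ((1 - P) *ᵥ v) := by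
    intro v
    symm
    rw [star_mulVec, ← dotProduct_mulVec, mulVec_mulVec, h1P.eq, h1Psq]
  have hH' : (H + (1 - P)).PosDef := by
    refine PosDef.of_dotProduct_mulVec_pos (hH.1.add h1P) fun v hv => ?_
    rw [add_mulVec, dotProduct_add]
    have h1 : 0 ≤ star v ⬝ᵥ H *ᵥ v := hH.dotProduct_mulVec_nonneg v
    have h2 : 0 ≤ star v ⬝ᵥ (1 - P) *ᵥ v := by
      rw [hquad1P]; exact dotProduct_star_self_nonneg _
    refine lt_of_le_of_ne (add_nonneg h1 h2) fun h0 => hv ?_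
    have hz := (add_eq_zero_iff_of_nonneg h1 h2).1 h0.symm
    have hHv : H *ᵥ v = 0 := (hH.dotProduct_mulVec_zero_iff v).1 hz.1
    have h1Pv : (1 - P) *ᵥ v = 0 := by
      have := hz.2
      rwa [hquad1P, dotProduct_star_self_eq_zero] at this
    have hPv : P *ᵥ v = 0 := hker₂ v hHv
    have : v = (1 - P) *ᵥ v + P *ᵥ v := by
      rw [sub_mulVec, one_mulVec, sub_add_cancel]
    rw [this, h1Pv, hPv, add_zero]
  obtain ⟨η, hη, hHη⟩ := exists_pos_sub_smul_posSemidef hH' isHermitian_one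
  refine ⟨η⁻¹, inv_pos.2 hη, ?_⟩
  refine PosSemidef.of_dotProduct_mulVec_nonneg
    ((isHermitian_real_smul hH.1 _).sub hPh) fun v => ?_
  -- decompose `v = w + u`, `w = P v`, `u = (1 - P) v`
  set w := P *ᵥ v with hw
  set u := (1 - P) *ᵥ v with hu
  have hvwu : v = w + u := by rw [hw, hu, sub_mulVec, one_mulVec, add_sub_cancel]
  have hHu : H *ᵥ u = 0 := hker₁ u (by rw [hu, mulVec_mulVec, Matrix.mul_sub, Matrix.mul_one,
    hPP, sub_self, zero_mulVec])
  have h1Pw : (1 - P) *ᵥ w = 0 := by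
    rw [hw, mulVec_mulVec, Matrix.sub_mul, Matrix.one_mul, hPP, sub_self, zero_mulVec]
  -- `v† H v = w† H w`
  have hvHv : star v ⬝ᵥ H *ᵥ v = star w ⬝ᵥ H *ᵥ w := by
    conv_lhs => rw [hvwu, mulVec_add, hHu, add_zero, star_add, add_dotProduct]
    have : star u ⬝ᵥ H *ᵥ w = 0 := by
      rw [dotProduct_mulVec, ← hH.1.eq, ← star_mulVec, hHu, star_zero, zero_dotProduct]
    rw [this, add_zero]
  -- `v† P v = w† w`
  have hvPv : star v ⬝ᵥ P *ᵥ v = star w ⬝ᵥ w := by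
    symm
    rw [hw, star_mulVec, ← dotProduct_mulVec, mulVec_mulVec, hPh.eq, hPP]
  -- `w† H w = w† H' w ≥ η w† w`
  have hwH' : star w ⬝ᵥ (H + (1 - P)) *ᵥ w = star w ⬝ᵥ H *ᵥ w := by
    rw [add_mulVec, h1Pw, add_zero]
  have hlow : 0 ≤ star w ⬝ᵥ H *ᵥ w - (η : ℂ) * (star w ⬝ᵥ w) := by
    have h := hHη.dotProduct_mulVec_nonneg w
    rwa [sub_mulVec, dotProduct_sub, hwH', smul_mulVec, one_mulVec, dotProduct_smul,
      smul_eq_mul] at h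
  rw [sub_mulVec, dotProduct_sub, smul_mulVec, dotProduct_smul, smul_eq_mul, hvHv, hvPv]
  have hid : ((η⁻¹ : ℝ) : ℂ) * (star w ⬝ᵥ H *ᵥ w) - star w ⬝ᵥ w =
      ((η⁻¹ : ℝ) : ℂ) * (star w ⬝ᵥ H *ᵥ w - (η : ℂ) * (star w ⬝ᵥ w)) := by
    rw [mul_sub, ← mul_assoc, ← Complex.ofReal_mul, inv_mul_cancel₀ hη.ne', Complex.ofReal_one,
      one_mul]
  rw [hid]
  exact mul_nonneg (Complex.zero_le_real.2 (inv_nonneg.2 hη.le)) hlow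

end QLattice

end Literature.MathematicalPhysics.QuantumLattice
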